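import Summits.HodgeConjecture.HodgeConjecture.Theorems.VHCAbelianSchemesRoadSecantQuotientAnchorPinnedDefs
import Summits.HodgeConjecture.HodgeConjecture.Theorems.VHCAbelianSchemesRoadServedFibreAnchors
import Summits.HodgeConjecture.HodgeConjecture.Theorems.VHCAbelianSchemesRoadEllipticPowerAnchors
import HarnessLib

/-!
# Road b02 (`VHCAbelianSchemesRoad`, D-0059) — THE PINNED `(6,3)` RESIDUAL (stub 2b″ of skeleton v3.1 of crux
# `SemiregularSheafRepresentativesTwAtDiag`, item stmt-HodgeConjecture-19787): THE CONVERSE OF OBSTRUCTION (O2) and THE FIRST HONEST SPECIAL FIBRE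

research route conditional on HC_CM; not a corollary; Q11.4-sentence-2 already refuted in dim ≥ 3.

FACT-FREE; `HC_CM` nowhere; no `def`; door-, degree- and anchor-generic in §1–§3a, instantiated at the pinned secant–quotient data
`(𝔄^pin, 𝔖^pin)` of `VHCAbelianSchemesRoadSecantQuotientAnchorPinnedDefs` (p512578) and at the ELLIPTIC-POWER anchor data of
`VHCAbelianSchemesRoadEllipticPowerAnchors` in §3b–§4. Sequel to `VHCAbelianSchemesRoadSecantQuotientResidualPinned` (p518116: the sandwich
UPPER ∕ LOWER and the obstructions (O1) per variety, (O2) per pencil). The stub `stub_residual_63_secantQuotientPinned : ∀ C,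
SecantQuotientResidual63Pinned C` (T3 PLAN-ONLY designate of record) is NOT restated, claimed or weakened: every theorem IMPLIES it (or a
conditional cell containing it) from a named statement, or is an equivalence between two of its sub-statements (ring2-b03 gen 81 on
director-hodge g7's line «next = the obstruction's converse direction or the first honest special fibre», 2026-08-27, under LEAD 154).

§1 THE CONVERSE OF (O2). (O2) (`exists_pinned_of_secantQuotientResidual63Pinned`) says: on a residual pencil with a fibre of Picard number one
in Hodge form w.r.t. a global `Θ`, (b″) DELIVERS a datum pinned in degree `p`: `V_p ≡ a·W + c·Θᵖ` on every fibre, `κ_p = V_p|_{s₁}`. Conversely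
(`lefAtDatum_of_pinned_fibrewise`, per pencil; `under_of_forall_exists_pinnedDatum`, per conditional cell): such a datum at ANY fibre `s₁`, w.r.t.
ANY global `Θ` with rational `(1,1)` restrictions, IS a datum of the cell — `Z := V_p − a·W` restricts to `c·(Θᵖ)|` on every fibre, algebraic
(Lefschetz `(1,1)`, the tree's `lefschetzOneOne_rational_holds`, and `θ ∈ N¹ ⟹ θᵖ ∈ Nᵖ`) and Lefschetz. Hence, on the sub-family of pencils
carrying a Picard-rank-one fibre, THE CONDITIONAL CELL IS EXACTLY «A PINNED DATUM SOMEWHERE» (`under_and_rankOne_iff_forall_exists_pinnedDatum`;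
(6,3)-pinned instance: `P := ¬ HasServedFibre 6 3 𝔄^pin 𝔖^pin`): (O2) and its converse in one line, no slack on that sub-family.

§2 SPECIAL-FIBRE CARRIERS SHRINK ANY CONDITIONAL CELL (anchor-generic): for a second anchor datum `(𝔄♭, 𝔖♭)`, `AnchoredCarrierAt 𝒪 n p 𝔄♭ 𝔖♭`
∧ the cell under `P ∧ ¬ HasServedFibre 𝔄♭ 𝔖♭` ⟹ the cell under `P` (`under_of_anchoredCarrierAt_of_under_and_not`; `iff` form): every
per-variety carrier statement at a class of SPECIAL fibres removes from the residual the pencils THROUGH such a fibre.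

§3 THE FIRST HONEST SPECIAL FIBRE — ELLIPTIC POWERS. At a fibre `𝒳_{s♭} ≅ A₀`, `A₀` an abelian `n`-fold ISOGENOUS TO A POWER `E₀^{N+1}` OF AN
ELLIPTIC CURVE (the `E_K³ × Ē_K³`-type points, which lie on EVERY `(3, d, δ)` Weil-type component, split or not: hermitian forms over `K`
diagonalise), every fibrewise rational `(p,p)` class is ALGEBRAIC, unconditionally (Tate–Murasaki, the tree's PROVED
`EllipticCurve.hodgeConjectureFor_of_isIsogenous_powSucc`, as `mem_algebraicClasses_of_ellipticPowerAnchor`), and — on `E₀^{N+1}` itself —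
LEFSCHETZ (`EllipticCurve.hodgeClasses_divisorial_powSucc`; here `mem_divisorClassesSpan_of_iso_powSucc`). So (§3a, any base of the cell's shape:
`hasServedFibre_algebraic_of_fibre`, `hasServedFibre_of_ellipticPowerFibre`) a pencil with an elliptic-power fibre is SERVED there for the
anchor data «`X ≅` an abelian `n`-fold isogenous to an elliptic power, `θ` a polarisation class» ∕ «algebraic classes» — VERBATIM the anchor
data of `VHCAbelianSchemesRoadEllipticPowerAnchors` — and (§3b) **(b″) ⟸ `AnchoredCarrierAt (tw C AdmTw) 6 3 𝔄_ell 𝔄lg` ∧ the DOUBLY residual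
cell (no pinned-served fibre AND no elliptic-power fibre)** (`secantQuotientResidual63Pinned_of_ellipticPowerCarrierAt_of_under_not_not`), the
first conjunct being a find-the-sheaf problem about LEFSCHETZ classes on polarised elliptic-power sixfolds: an `AdmTw`-admissible `B`-twisted
object with `κ₃ = a·w + c·θ³`, `a ≠ 0`, for `w` a prescribed polynomial in divisor classes (for the non-split Weil pencils: `w` = the limit of
the Weil class at `E_K³ × Ē_K³`, `θ` = the polarisation of the component — NOT the product principal one when `δ ∉ −N(K^×)`).

§4 THE DOOR-LEVEL FORM AT `I = {3}` (`anchoredCarrierAt_twisted_of_forall_exists_isISemiregular`): for any notion `Adm ⊇ bfSingleAdmissible`, a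
`{2}`-semiregular vector bundle `F` (`σ₂ : Ext²(F,F) → H⁴(Ω²)` injective) with a rational algebraic `B`-field `B₀` and `(e^{B₀} ch F)₃ = a·w + c·θ³`
at every anchor gives the anchored-carrier statement with `I = {3}` — NO side degree is typed. HONEST READING (not a theorem here): the side
conditions RETURN through the deformation theory the door fact encodes (`σ_q(o(ℱ)) = 0 ⟺ ch_{q+1}` stays in `F^{q+1}`, componentwise: Pridham
Cor. 2.25 ∕ Rem. 2.26 — a `{2}`-semiregular object whose `κ₃` stays Hodge DEFORMS, so ALL its `κ_q` stay Hodge); on a non-split `(3,d,δ)` pencil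
through `E_K³ × Ē_K³` a candidate `F = ⊕ L_i` must have CENTRED power sums `Σ (l_i − l̄)^k ∈ ℚ·θᵏ` (`k = 1, 2, 4, 5`), `∈ ℚ^×·w + ℚ·θ³` (`k = 3`),
differences `l_i − l_j` non-degenerate of index `∉ {2, 4}` (Mumford: the off-diagonal `Ext² = H²(L_j ⊗ L_i⁻¹)`, killed by the trace, must vanish)
and at most `495 ∕ 15 = 33` summands (`dim ⊕_q H^{q,q+2} ∕ dim H^{0,2}`) — the design problem stated in full in this generation's evidence memo.

What is NOT claimed: (b″), (a″), the rung, the crux, any carrier statement, any cell, K-SR♭∃, VHC, `HC_AV`, HC; that elliptic-power carriers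
exist; that any pencil of the residual HAS an elliptic-power fibre (family supply is not in the tree: the sub-partition of §3b is bookkeeping,
non-vacuous in nature — every `(3,d,δ)` component contains `E_K³ × Ē_K³` points — and untyped here).
References: [cite: Bloch1972Semiregularity, Remark (7.5)] [cite: BuchweitzFlenner2003, Def. 4.1, §5 Thm. 5.1] [cite: Pridham2024Semiregularity,
Cor. 2.25, Rem. 2.26 and Rem. 2.27] [cite: vanGeemen1994HodgeAV, §2.4, Thm. 4.3, Thm. 4.11, Lemma 5.2] [cite: Markman2025SecantWeil, §1.1, Thm.
1.4.1 and Thm. 1.5.1] [cite: MumfordAV1970, §16 (the index theorem)] [cite: Mukai1978, §5–§6] [cite: MoonenZarhin1999LowDim, (2.1) and Cor. 3.9]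
[cite: DeligneHodgeII1971, Cor. 4.1.2 (proof)] [cite: VoisinHodgeI2002, Thm. 6.25, Thm. 7.10 and §7.1.2] [cite: Andre1996Motifs, Lemme 6.3.3 (ii) (p. 33)].
-/

noncomputable section

open CategoryTheory CategoryTheory.Limits AlgebraicGeometry Topology

-- the cell's namespace repeats the summit name (`Summit.HodgeConjecture.HodgeConjecture…`), as in every `Ring2*` file
set_option linter.dupNamespace false

namespace Summit.HodgeConjecture.HodgeConjecture.Ring2.SemiregularRepresentatives

open Literature.AlgebraicGeometry Literature.AlgebraicGeometry.Motives
open Literature.AlgebraicGeometry.HodgeTheory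
open Literature.AlgebraicTopology.SingularHomology
open Literature.Barriers.HodgeConjecture (divisorClassesSpan)
open Summit.Ventures.HSemireg (ObjClass)
open Summit.HodgeConjecture.HodgeConjecture.Ring2.Binders (exists_forall_isPolarizationClass_map_fiberι)

variable {𝒪 : ObjClass} {n p : ℕ}
variable {𝒳 S : SchemeOver ℂ} {f : 𝒳 ⟶ S}

/-! ## §1 The converse of (O2): a datum pinned in degree `p` at SOME fibre is a datum of the cell; the `iff` on the Picard-rank-one sub-family -/

/-- **THE CONVERSE OF (O2), PER PENCIL.** On a smooth projective family `f` of relative dimension `n`, let `Θ ∈ H²(𝒳(ℂ); ℂ)` be ANY global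
class with rational `(1,1)` restrictions and `W` any global class of degree `2p`. A fibre `s₁`, degrees `I ∋ p`, an `𝒪`-datum `κ` ON `𝒳_{s₁}`,
global classes `V_q` with `(q,q)` restrictions everywhere, `a ≠ 0` and a scalar `c` with `V_p|_s = a·W|_s + c·(Θᵖ)|_s` ON EVERY FIBRE and
`κ_q = V_q|_{s₁}` (`q ∈ I`) — exactly the output shape of (O2) — give the conclusion of K-SR♭∃ ∕ of every cell for `(f, W)`: `Z := V_p − a·W`
restricts to `c·(Θᵖ)|_s`, ALGEBRAIC (Lefschetz `(1,1)` on the fibre, then `θ ∈ N¹ ⟹ θᵖ ∈ Nᵖ`) and LEFSCHETZ. No hypothesis on the base, no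
regime hypothesis. [cite: Bloch1972Semiregularity, Remark (7.5)] [cite: VoisinHodgeI2002, Thm. 7.10 and §7.1.2] [cite: vanGeemen1994HodgeAV, §2.4] -/
theorem lefAtDatum_of_pinned_fibrewise (hf : IsSmoothProjectiveFamily f n) (Θ : complexBetti 𝒳 2)
    (hΘQ : ∀ s : ComplexPoints S, IsRationalClass (complexBetti.map (fiberι f s) 2 Θ))
    (hΘH : ∀ s : ComplexPoints S, IsOfHodgeType n (fiberOver f s) 2 1 1 (complexBetti.map (fiberι f s) 2 Θ))
    (W : complexBetti 𝒳 (2 * p)) {s₁ : ComplexPoints S} {I : Finset ℕ} {κ : (q : ℕ) → complexBetti (fiberOver f s₁) (2 * q)}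
    {V : (q : ℕ) → complexBetti 𝒳 (2 * q)} {a c : ℂ} (hpI : p ∈ I) (h𝒪 : 𝒪 n (fiberOver f s₁) I κ) (ha : a ≠ 0)
    (hVp : ∀ s : ComplexPoints S, complexBetti.map (fiberι f s) (2 * p) (V p) =
      a • complexBetti.map (fiberι f s) (2 * p) W + c • complexBetti.map (fiberι f s) (2 * p) (cupPowTwo Θ p))
    (hκV : ∀ q ∈ I, κ q = complexBetti.map (fiberι f s₁) (2 * q) (V q))
    (hVH : ∀ q ∈ I, ∀ s : ComplexPoints S, IsOfHodgeType n (fiberOver f s) (2 * q) q q (complexBetti.map (fiberι f s) (2 * q) (V q))) :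
    ∃ (s₁ : ComplexPoints S) (I : Finset ℕ) (κ : (q : ℕ) → complexBetti (fiberOver f s₁) (2 * q))
      (V : (q : ℕ) → complexBetti 𝒳 (2 * q)) (a : ℂ) (Z : complexBetti 𝒳 (2 * p)),
      p ∈ I ∧ 𝒪 n (fiberOver f s₁) I κ ∧ a ≠ 0 ∧
      (∀ s : ComplexPoints S,
        complexBetti.map (fiberι f s) (2 * p) Z ∈ algebraicClasses (fiberOver f s) p ∧
        complexBetti.map (fiberι f s) (2 * p) Z ∈ divisorClassesSpan (fiberOver f s) n p) ∧
      V p = a • W + Z ∧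
      (∀ q ∈ I, κ q = complexBetti.map (fiberι f s₁) (2 * q) (V q)) ∧
      (∀ q ∈ I, ∀ s : ComplexPoints S, IsOfHodgeType n (fiberOver f s) (2 * q) q q (complexBetti.map (fiberι f s) (2 * q) (V q))) := by
  refine ⟨s₁, I, κ, V, a, V p - a • W, hpI, h𝒪, ha, fun s ↦ ?_, by abel, hκV, hVH⟩
  have hZ : complexBetti.map (fiberι f s) (2 * p) (V p - a • W) = complexBetti.map (fiberι f s) (2 * p) (c • cupPowTwo Θ p) := by
    rw [map_sub, map_smul, map_smul, hVp s, add_sub_cancel_left]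
  rw [hZ]
  refine ⟨?_, smul_cupPowTwo_map_mem_divisorClassesSpan Θ s (hΘQ s) (hΘH s) c p⟩
  rw [map_smul]
  exact Submodule.smul_mem _ _ (map_cupPowTwo_mem_algebraicClasses hf Θ s
    (lefschetzOneOne_rational_holds (hf.isSmoothProjective s) _ (hΘQ s) (hΘH s)) p)

/-- **THE CONVERSE OF (O2), PER CONDITIONAL CELL: «a datum pinned in degree `p` at SOME fibre of every `P`-pencil» ⟹ the cell under `P`**
(every door, every `(n, p)`, every pencil-level hypothesis `P` — e.g. `P = ¬ HasServedFibre n p 𝔄 𝔖`, a residual). The hypothesis asks, on every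
one-parameter abelian scheme of the cell's shape satisfying `P`, for SOME fibre `s₁`, SOME global `Θ` with rational `(1,1)` restrictions and a
datum of (O2)'s output shape there. [cite: Bloch1972Semiregularity, Remark (7.5)] [cite: vanGeemen1994HodgeAV, §2.4 and Thm. 4.11]
[cite: VoisinHodgeI2002, Thm. 7.10 and §7.1.2] -/
theorem under_of_forall_exists_pinnedDatum {P : ∀ ⦃𝒳 S : SchemeOver ℂ⦄, (𝒳 ⟶ S) → complexBetti 𝒳 (2 * p) → Prop}
    (h : ∀ ⦃𝒳 S : SchemeOver ℂ⦄ (f : 𝒳 ⟶ S), IsSmoothProjectiveFamily f n → IsQuasiProjectiveOver 𝒳 →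
      IrreducibleSpace S.left → IsAffine S.left → AlgebraicGeometry.Smooth S.hom → topologicalKrullDim S.left = 1 →
      (∀ s : ComplexPoints S, ∃ A' : AbelianVariety ℂ, A'.dim = n ∧ Nonempty (A'.X ≅ fiberOver f s)) →
      (∃ e : S ⟶ 𝒳, e ≫ f = 𝟙 S) →
      ∀ (W : complexBetti 𝒳 (2 * p)),
        (∀ s : ComplexPoints S, IsRationalClass (complexBetti.map (fiberι f s) (2 * p) W) ∧
          IsOfHodgeType n (fiberOver f s) (2 * p) p p (complexBetti.map (fiberι f s) (2 * p) W)) →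
        ∀ s₀ : ComplexPoints S,
          complexBetti.map (fiberι f s₀) (2 * p) W ∈ algebraicClasses (fiberOver f s₀) p →
          (¬ ∀ s : ComplexPoints S,
            complexBetti.map (fiberι f s) (2 * p) W ∈ algebraicClasses (fiberOver f s) p ∧
            complexBetti.map (fiberι f s) (2 * p) W ∈ divisorClassesSpan (fiberOver f s) n p) →
          P f W →
          ∃ (s₁ : ComplexPoints S) (Θ : complexBetti 𝒳 2) (I : Finset ℕ) (κ : (q : ℕ) → complexBetti (fiberOver f s₁) (2 * q))
            (V : (q : ℕ) → complexBetti 𝒳 (2 * q)) (a c : ℂ),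
            (∀ s : ComplexPoints S, IsRationalClass (complexBetti.map (fiberι f s) 2 Θ)) ∧
            (∀ s : ComplexPoints S, IsOfHodgeType n (fiberOver f s) 2 1 1 (complexBetti.map (fiberι f s) 2 Θ)) ∧
            p ∈ I ∧ 𝒪 n (fiberOver f s₁) I κ ∧ a ≠ 0 ∧
            (∀ s : ComplexPoints S, complexBetti.map (fiberι f s) (2 * p) (V p) =
              a • complexBetti.map (fiberι f s) (2 * p) W + c • complexBetti.map (fiberι f s) (2 * p) (cupPowTwo Θ p)) ∧
            (∀ q ∈ I, κ q = complexBetti.map (fiberι f s₁) (2 * q) (V q)) ∧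
            (∀ q ∈ I, ∀ s : ComplexPoints S,
              IsOfHodgeType n (fiberOver f s) (2 * q) q q (complexBetti.map (fiberι f s) (2 * q) (V q)))) :
    LefAtExceptionalRegimeAtUnder 𝒪 n p P := by
  intro 𝒳 S f hf h𝒳 hirr haff hsm hdim hab hsec W hW s₀ halg hexc hP
  obtain ⟨s₁, Θ, I, κ, V, a, c, hΘQ, hΘH, hpI, h𝒪, ha, hVp, hκV, hVH⟩ :=
    h f hf h𝒳 hirr haff hsm hdim hab hsec W hW s₀ halg hexc hP
  exact lefAtDatum_of_pinned_fibrewise hf Θ hΘQ hΘH W hpI h𝒪 ha hVp hκV hVH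

/-- **ON THE PICARD-RANK-ONE SUB-FAMILY THE CONDITIONAL CELL IS EXACTLY «A PINNED DATUM SOMEWHERE» — (O2) AND ITS CONVERSE IN ONE LINE.**
For every door `𝒪`, every `(n, p)` and every pencil-level hypothesis `P`: the cell under «`P` ∧ the pencil carries a global `Θ` with rational
`(1,1)` restrictions and a fibre `s♯` at which every rational `(1,1)` class lies on `ℂ·Θ|_{s♯}`» (a very general NON-SPLIT `(3, d, δ)` Weil-type
pencil: `B¹ = ℚθ` at the very general member, van Geemen Thm. 4.11 ∕ Lemma 5.2) holds IFF on every `P`-pencil of the cell's shape, for every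
such `Θ` and `s♯`, SOME fibre `s₁` carries an `𝒪`-datum with `V_p ≡ a·W + c·Θᵖ` fibrewise, `κ_p = V_p|_{s₁}`, `a ≠ 0` (⟹: PART
`LefschetzSlackPin`, `pinned_of_lefAtDatum`; ⟸: `lefAtDatum_of_pinned_fibrewise`). [cite: vanGeemen1994HodgeAV, Thm. 4.11, §2.4 and Lemma 5.2]
[cite: DeligneHodgeII1971, Cor. 4.1.2 (proof)] [cite: Bloch1972Semiregularity, Remark (7.5)] -/
theorem under_and_rankOne_iff_forall_exists_pinnedDatum {P : ∀ ⦃𝒳 S : SchemeOver ℂ⦄, (𝒳 ⟶ S) → complexBetti 𝒳 (2 * p) → Prop} :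
    LefAtExceptionalRegimeAtUnder 𝒪 n p (fun 𝒳 S f W ↦ P f W ∧ ∃ Θ : complexBetti 𝒳 2,
      (∀ s : ComplexPoints S, IsRationalClass (complexBetti.map (fiberι f s) 2 Θ)) ∧
      (∀ s : ComplexPoints S, IsOfHodgeType n (fiberOver f s) 2 1 1 (complexBetti.map (fiberι f s) 2 Θ)) ∧
      ∃ s' : ComplexPoints S, ∀ b : complexBetti (fiberOver f s') 2, IsRationalClass b →
        IsOfHodgeType n (fiberOver f s') 2 1 1 b → b ∈ ℂ ∙ complexBetti.map (fiberι f s') 2 Θ) ↔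
    ∀ ⦃𝒳 S : SchemeOver ℂ⦄ (f : 𝒳 ⟶ S), IsSmoothProjectiveFamily f n → IsQuasiProjectiveOver 𝒳 →
      IrreducibleSpace S.left → IsAffine S.left → AlgebraicGeometry.Smooth S.hom → topologicalKrullDim S.left = 1 →
      (∀ s : ComplexPoints S, ∃ A' : AbelianVariety ℂ, A'.dim = n ∧ Nonempty (A'.X ≅ fiberOver f s)) →
      (∃ e : S ⟶ 𝒳, e ≫ f = 𝟙 S) →
      ∀ (W : complexBetti 𝒳 (2 * p)),
        (∀ s : ComplexPoints S, IsRationalClass (complexBetti.map (fiberι f s) (2 * p) W) ∧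
          IsOfHodgeType n (fiberOver f s) (2 * p) p p (complexBetti.map (fiberι f s) (2 * p) W)) →
        ∀ s₀ : ComplexPoints S,
          complexBetti.map (fiberι f s₀) (2 * p) W ∈ algebraicClasses (fiberOver f s₀) p →
          (¬ ∀ s : ComplexPoints S,
            complexBetti.map (fiberι f s) (2 * p) W ∈ algebraicClasses (fiberOver f s) p ∧
            complexBetti.map (fiberι f s) (2 * p) W ∈ divisorClassesSpan (fiberOver f s) n p) →
          P f W →
          ∀ (Θ : complexBetti 𝒳 2), (∀ s : ComplexPoints S, IsRationalClass (complexBetti.map (fiberι f s) 2 Θ)) →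
            (∀ s : ComplexPoints S, IsOfHodgeType n (fiberOver f s) 2 1 1 (complexBetti.map (fiberι f s) 2 Θ)) →
            ∀ s' : ComplexPoints S, (∀ b : complexBetti (fiberOver f s') 2, IsRationalClass b →
              IsOfHodgeType n (fiberOver f s') 2 1 1 b → b ∈ ℂ ∙ complexBetti.map (fiberι f s') 2 Θ) →
              ∃ (s₁ : ComplexPoints S) (I : Finset ℕ) (κ : (q : ℕ) → complexBetti (fiberOver f s₁) (2 * q))
                (V : (q : ℕ) → complexBetti 𝒳 (2 * q)) (a c : ℂ),
                p ∈ I ∧ 𝒪 n (fiberOver f s₁) I κ ∧ a ≠ 0 ∧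
                (∀ s : ComplexPoints S, complexBetti.map (fiberι f s) (2 * p) (V p) =
                  a • complexBetti.map (fiberι f s) (2 * p) W + c • complexBetti.map (fiberι f s) (2 * p) (cupPowTwo Θ p)) ∧
                (∀ q ∈ I, κ q = complexBetti.map (fiberι f s₁) (2 * q) (V q)) ∧
                (∀ q ∈ I, ∀ s : ComplexPoints S,
                  IsOfHodgeType n (fiberOver f s) (2 * q) q q (complexBetti.map (fiberι f s) (2 * q) (V q))) := by
  refine ⟨fun hU 𝒳 S f hf h𝒳 hirr haff hsm hdim hab hsec W hW s₀ halg hexc hP Θ hΘQ hΘH s' hpic ↦ ?_, fun hR ↦ ?_⟩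
  · obtain ⟨s₁, I, κ, V, a, Z, hpI, h𝒪, ha, hZ, hVp, hκV, hVH⟩ :=
      hU f hf h𝒳 hirr haff hsm hdim hab hsec W hW s₀ halg hexc ⟨hP, Θ, hΘQ, hΘH, s', hpic⟩
    obtain ⟨c, hV, -⟩ := pinned_of_lefAtDatum hf hirr hsm Θ hpic W Z (V p) a (κ p) hVp (hκV p hpI) fun s ↦ (hZ s).2
    exact ⟨s₁, I, κ, V, a, c, hpI, h𝒪, ha, hV, hκV, hVH⟩
  · intro 𝒳 S f hf h𝒳 hirr haff hsm hdim hab hsec W hW s₀ halg hexc hP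
    obtain ⟨hP, Θ, hΘQ, hΘH, s', hpic⟩ := hP
    obtain ⟨s₁, I, κ, V, a, c, hpI, h𝒪, ha, hVp, hκV, hVH⟩ :=
      hR f hf h𝒳 hirr haff hsm hdim hab hsec W hW s₀ halg hexc hP Θ hΘQ hΘH s' hpic
    exact lefAtDatum_of_pinned_fibrewise hf Θ hΘQ hΘH W hpI h𝒪 ha hVp hκV hVH

/-! ## §2 Special-fibre carriers shrink any conditional cell (anchor-generic) -/

variable {𝔄' : ∀ X : SchemeOver ℂ, complexBetti X 2 → Prop} {𝔖' : ∀ (X : SchemeOver ℂ), complexBetti X 2 → Set (complexBetti X (2 * p))}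

/-- **A CARRIER STATEMENT AT A CLASS OF SPECIAL FIBRES REMOVES THE PENCILS THROUGH THEM FROM ANY CONDITIONAL CELL**: for anchor data
`(𝔄♭, 𝔖♭)`, `AnchoredCarrierAt 𝒪 n p 𝔄♭ 𝔖♭` and the cell under `P ∧ ¬ HasServedFibre n p 𝔄♭ 𝔖♭` give the cell under `P` (excluded middle +
the transport `exists_lefAtDatum_of_anchoredCarrierAt`). With `P` a residual this is the structural form of the converse of (O2): settle the
special fibres by a per-variety statement, keep the doubly-residual. [cite: Bloch1972Semiregularity, Remark (7.5)]
[cite: vanGeemen1994HodgeAV, §2.4 and Thm. 4.11] [cite: Markman2025SecantWeil, Thm. 1.4.1] -/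
theorem under_of_anchoredCarrierAt_of_under_and_not {P : ∀ ⦃𝒳 S : SchemeOver ℂ⦄, (𝒳 ⟶ S) → complexBetti 𝒳 (2 * p) → Prop}
    (hA : AnchoredCarrierAt 𝒪 n p 𝔄' 𝔖')
    (hR : LefAtExceptionalRegimeAtUnder 𝒪 n p (fun _ _ f W ↦ P f W ∧ ¬ HasServedFibre n p 𝔄' 𝔖' f W)) :
    LefAtExceptionalRegimeAtUnder 𝒪 n p P := by
  intro 𝒳 S f hf h𝒳 hirr haff hsm hdim hab hsec W hW s₀ halg hexc hP
  by_cases h' : HasServedFibre n p 𝔄' 𝔖' f W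
  · exact exists_lefAtDatum_of_anchoredCarrierAt hA hf W hW h'
  · exact hR f hf h𝒳 hirr haff hsm hdim hab hsec W hW s₀ halg hexc ⟨hP, h'⟩

/-- **… and conversely nothing is lost**: granted the carrier statement at `(𝔄♭, 𝔖♭)`, the cell under `P` ⟺ the cell under
`P ∧ ¬ HasServedFibre n p 𝔄♭ 𝔖♭`. [folklore] [cite: Bloch1972Semiregularity, Remark (7.5)] -/
theorem under_iff_under_and_not_of_anchoredCarrierAt {P : ∀ ⦃𝒳 S : SchemeOver ℂ⦄, (𝒳 ⟶ S) → complexBetti 𝒳 (2 * p) → Prop}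
    (hA : AnchoredCarrierAt 𝒪 n p 𝔄' 𝔖') :
    LefAtExceptionalRegimeAtUnder 𝒪 n p P ↔
      LefAtExceptionalRegimeAtUnder 𝒪 n p (fun _ _ f W ↦ P f W ∧ ¬ HasServedFibre n p 𝔄' 𝔖' f W) :=
  ⟨under_mono fun _ _ _ _ h ↦ h.1, under_of_anchoredCarrierAt_of_under_and_not hA⟩

/-! ## §3a Fibres at which every rational `(p,p)` class is algebraic are served for «algebraic classes»; elliptic-power fibres -/

/-- **A FIBRE AT WHICH EVERY RATIONAL `(p,p)` CLASS IS ALGEBRAIC IS A SERVED FIBRE** for any anchor predicate `𝔄₀` satisfied by that fibre with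
every polarisation class, and the served-class map «algebraic classes»: polarise by the relative hyperplane class of the quasi-projective total
space over the affine base (`exists_forall_isPolarizationClass_map_fiberι`). Elliptic powers below; CM fibres granted `HC_CM` by name (not here).
[cite: VoisinHodgeI2002, Thm. 6.25, Thm. 7.10 and §7.1.2] [cite: Bloch1972Semiregularity, Remark (7.5)] -/
theorem hasServedFibre_algebraic_of_fibre {𝔄₀ : ∀ X : SchemeOver ℂ, complexBetti X 2 → Prop} (hf : IsSmoothProjectiveFamily f n)
    (h𝒳 : IsQuasiProjectiveOver 𝒳) [IsAffine S.left] {t : ComplexPoints S}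
    (h𝔄₀ : ∀ θ : complexBetti (fiberOver f t) 2, IsPolarizationClass n (fiberOver f t) θ → 𝔄₀ (fiberOver f t) θ)
    (halg : ∀ w : complexBetti (fiberOver f t) (2 * p), IsRationalClass w → IsOfHodgeType n (fiberOver f t) (2 * p) p p w →
      w ∈ algebraicClasses (fiberOver f t) p)
    (W : complexBetti 𝒳 (2 * p))
    (hW : ∀ s : ComplexPoints S, IsRationalClass (complexBetti.map (fiberι f s) (2 * p) W) ∧
      IsOfHodgeType n (fiberOver f s) (2 * p) p p (complexBetti.map (fiberι f s) (2 * p) W)) :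
    HasServedFibre n p 𝔄₀ (fun X _ ↦ (algebraicClasses X p : Set (complexBetti X (2 * p)))) f W := by
  haveI : IsSeparated S.hom := isSeparated_hom_of_isAffine S
  obtain ⟨Θ, hΘ⟩ := exists_forall_isPolarizationClass_map_fiberι f hf h𝒳
  exact ⟨t, Θ, fun s ↦ (hΘ s).isRationalClass,
    fun s ↦ isOfHodgeType_of_mem_algebraicClasses_of_isSmoothProjective (hf.isSmoothProjective s) 1 (hΘ s).mem_algebraicClasses,
    h𝔄₀ _ (hΘ t), halg _ (hW t).1 (hW t).2⟩

/-- **A PENCIL WITH AN ELLIPTIC-POWER FIBRE IS SERVED THERE** (affine base, quasi-projective total space — the cell's shape; the compact twin is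
`hasServedFibre_compactPencil_of_ellipticPowerFibre`) for the anchor data of `VHCAbelianSchemesRoadEllipticPowerAnchors` VERBATIM: «`X ≅ A₀`,
`A₀` an abelian `n`-fold isogenous to `E₀^{N+1}`, `dim E₀ = 1`, `θ` a polarisation class» ∕ «algebraic classes» — Tate–Murasaki
(`mem_algebraicClasses_of_ellipticPowerAnchor`) makes `W|_{s♭}` algebraic. [cite: vanGeemen1994HodgeAV, Lemma 3.7 and Thm. 4.3]
[cite: MoonenZarhin1999LowDim, (2.1) and Cor. 3.9] [cite: VoisinHodgeI2002, Thm. 6.25 and Thm. 7.10] -/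
theorem hasServedFibre_of_ellipticPowerFibre (hf : IsSmoothProjectiveFamily f n) (h𝒳 : IsQuasiProjectiveOver 𝒳) [IsAffine S.left]
    {t : ComplexPoints S} {A₀ E₀ : AbelianVariety ℂ} {N : ℕ} (hd : A₀.dim = n) (hE₀ : E₀.dim = 1) (hiso : A₀.IsIsogenous (E₀.powSucc N))
    (e₀ : A₀.X ≅ fiberOver f t) (W : complexBetti 𝒳 (2 * p))
    (hW : ∀ s : ComplexPoints S, IsRationalClass (complexBetti.map (fiberι f s) (2 * p) W) ∧
      IsOfHodgeType n (fiberOver f s) (2 * p) p p (complexBetti.map (fiberι f s) (2 * p) W)) :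
    HasServedFibre n p
      (fun X θ ↦ (∃ (A₀ E₀ : AbelianVariety ℂ) (N : ℕ), A₀.dim = n ∧ E₀.dim = 1 ∧ A₀.IsIsogenous (E₀.powSucc N) ∧
        Nonempty (A₀.X ≅ X)) ∧ IsPolarizationClass n X θ)
      (fun X _ ↦ (algebraicClasses X p : Set (complexBetti X (2 * p)))) f W :=
  hasServedFibre_algebraic_of_fibre hf h𝒳 (fun _ hθ ↦ ⟨⟨A₀, E₀, N, hd, hE₀, hiso, ⟨e₀⟩⟩, hθ⟩)
    (fun _ hwQ hw ↦ mem_algebraicClasses_of_ellipticPowerAnchor hd hE₀ hiso e₀ hwQ hw) W hW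

/-- **At a fibre isomorphic to the power `E₀^{N+1}` itself, every rational `(p,p)` class is moreover LEFSCHETZ** (`Bᵖ = Dᵖ`, Tate–Murasaki —
the tree's `EllipticCurve.hodgeClasses_divisorial_powSucc`, moved along `e₀`): the served classes of §3 at such an anchor are POLYNOMIALS IN
DIVISOR CLASSES, so the carrier statement there is a find-the-sheaf problem for prescribed products of divisor classes modulo `θᵖ`.
[cite: vanGeemen1994HodgeAV, Thm. 4.3] [cite: Gordon1997, §3] [cite: MoonenZarhin1999LowDim, Cor. 3.9] -/
theorem mem_divisorClassesSpan_of_iso_powSucc {X : SchemeOver ℂ} {E₀ : AbelianVariety ℂ} {N : ℕ} (hE₀ : E₀.dim = 1)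
    (hd : (E₀.powSucc N).dim = n) (e₀ : (E₀.powSucc N).X ≅ X) {w : complexBetti X (2 * p)} (hwQ : IsRationalClass w)
    (hw : IsOfHodgeType n X (2 * p) p p w) : w ∈ divisorClassesSpan X n p := by
  subst hd
  have hXE : IsSmoothProjective (E₀.powSucc N).dim (E₀.powSucc N).X := AbelianVariety.isSmoothProjective_holds (A := E₀.powSucc N)
  have hX : IsSmoothProjective (E₀.powSucc N).dim X := hXE.of_iso e₀
  have h1 : complexBetti.map e₀.hom (2 * p) w ∈ divisorClassesSpan (E₀.powSucc N).X (E₀.powSucc N).dim p :=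
    EllipticCurve.hodgeClasses_divisorial_powSucc hE₀ N p (complexBetti.map e₀.hom (2 * p) w)
      ((isRationalClass_map_iff_of_iso e₀).2 hwQ) ((isOfHodgeType_map_iff_of_iso e₀).2 hw)
  have h2 := map_mem_divisorClassesSpan hX hXE e₀.inv h1
  rwa [e₀.complexBetti_map_inv_map_hom] at h2

/-! ## §3b The elliptic-power carrier statement settles the pencils THROUGH an elliptic-power fibre; (b″) ⟸ it ∧ the doubly residual -/

/-- **ELLIPTIC-POWER CARRIERS GIVE EVERY CELL ON THE PENCILS WITH AN ELLIPTIC-POWER FIBRE** (door-, degree-generic): `AnchoredCarrierAt 𝒪 n p`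
at «elliptic-power anchors» ∕ «algebraic classes» ⟹ the cell `(n, p)` under «some fibre is isomorphic to an abelian `n`-fold isogenous to a
power of an elliptic curve». [cite: Bloch1972Semiregularity, Remark (7.5)] [cite: vanGeemen1994HodgeAV, Thm. 4.3 and §2.4]
[cite: Andre1996Motifs, Lemme 6.3.3 (ii) (p. 33)] -/
theorem under_ellipticPowerFibre_of_ellipticPowerCarrierAt
    (hA : AnchoredCarrierAt 𝒪 n p
      (fun X θ ↦ (∃ (A₀ E₀ : AbelianVariety ℂ) (N : ℕ), A₀.dim = n ∧ E₀.dim = 1 ∧ A₀.IsIsogenous (E₀.powSucc N) ∧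
        Nonempty (A₀.X ≅ X)) ∧ IsPolarizationClass n X θ)
      (fun X _ ↦ (algebraicClasses X p : Set (complexBetti X (2 * p))))) :
    LefAtExceptionalRegimeAtUnder 𝒪 n p (fun _ S f _ ↦ ∃ (t : ComplexPoints S) (A₀ E₀ : AbelianVariety ℂ) (N : ℕ),
      A₀.dim = n ∧ E₀.dim = 1 ∧ A₀.IsIsogenous (E₀.powSucc N) ∧ Nonempty (A₀.X ≅ fiberOver f t)) := by
  intro 𝒳 S f hf h𝒳 hirr haff hsm hdim hab hsec W hW s₀ halg hexc hP
  obtain ⟨t, A₀, E₀, N, hd, hE₀, hiso, ⟨e₀⟩⟩ := hP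
  haveI := haff
  exact exists_lefAtDatum_of_anchoredCarrierAt hA hf W hW (hasServedFibre_of_ellipticPowerFibre hf h𝒳 hd hE₀ hiso e₀ W hW)

/-- **(b″) ⟸ ELLIPTIC-POWER CARRIERS ∧ THE DOUBLY RESIDUAL CELL** — the first honest special fibre typed: if at every polarised sixfold
`(X, θ)` with `X ≅ A₀ ~ E₀⁶` every rational algebraic (equivalently: every rational `(3,3)`, all Lefschetz) class `w` has an `AdmTw`-admissible
`B`-twisted datum with `κ₃ = a·w + c₃·θ³`, `a ≠ 0`, sides on the `θ`-ray, AND the twisted-door cell `(6,3)` holds on the pencils with NO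
pinned-served fibre AND NO elliptic-power fibre, then `SecantQuotientResidual63Pinned C`. The very general NON-SPLIT `(3, d, δ)` Weil pencils
through an `E_K³ × Ē_K³` point are in the FIRST conjunct's charge (their algebraic fibre can be taken there), with `w` the limit Weil class (a
Lefschetz class at that point) and `θ` the component's polarisation. [cite: vanGeemen1994HodgeAV, Thm. 4.3, Thm. 4.11 and Lemma 5.2]
[cite: Markman2025SecantWeil, Thm. 1.5.1 and §1.5] [cite: Bloch1972Semiregularity, Remark (7.5)] [cite: MoonenZarhin1999LowDim, Cor. 3.9] -/
theorem secantQuotientResidual63Pinned_of_ellipticPowerCarrierAt_of_under_not_not {C : ChernCharacterBetti}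
    (hE : AnchoredCarrierAt (Literature.AlgebraicGeometry.HodgeTheory.twistedReflexiveClass C
        (fun n X₀ I E => Summit.Ventures.HSemireg.gluableSigmaAdmissible n X₀ I E ∨
          Literature.AlgebraicGeometry.HodgeTheory.bfSingleAdmissible n X₀ I E)) 6 3
      (fun X θ ↦ (∃ (A₀ E₀ : AbelianVariety ℂ) (N : ℕ), A₀.dim = 6 ∧ E₀.dim = 1 ∧ A₀.IsIsogenous (E₀.powSucc N) ∧
        Nonempty (A₀.X ≅ X)) ∧ IsPolarizationClass 6 X θ)
      (fun X _ ↦ (algebraicClasses X 3 : Set (complexBetti X (2 * 3)))))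
    (hR : LefAtExceptionalRegimeAtUnder (Literature.AlgebraicGeometry.HodgeTheory.twistedReflexiveClass C
        (fun n X₀ I E => Summit.Ventures.HSemireg.gluableSigmaAdmissible n X₀ I E ∨
          Literature.AlgebraicGeometry.HodgeTheory.bfSingleAdmissible n X₀ I E)) 6 3
      (fun _ S f W ↦ ¬ HasServedFibre 6 3 (fun X θ ↦ secantQuotientAnchorsPinned X θ)
          (fun X θ ↦ secantQuotientServedClassesPinned X θ) f W ∧
        ¬ ∃ (t : ComplexPoints S) (A₀ E₀ : AbelianVariety ℂ) (N : ℕ),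
          A₀.dim = 6 ∧ E₀.dim = 1 ∧ A₀.IsIsogenous (E₀.powSucc N) ∧ Nonempty (A₀.X ≅ fiberOver f t))) :
    SecantQuotientResidual63Pinned C := by
  intro 𝒳 S f hf h𝒳 hirr haff hsm hdim hab hsec W hW s₀ halg hexc hns
  by_cases hell : ∃ (t : ComplexPoints S) (A₀ E₀ : AbelianVariety ℂ) (N : ℕ),
      A₀.dim = 6 ∧ E₀.dim = 1 ∧ A₀.IsIsogenous (E₀.powSucc N) ∧ Nonempty (A₀.X ≅ fiberOver f t)
  · exact under_ellipticPowerFibre_of_ellipticPowerCarrierAt hE f hf h𝒳 hirr haff hsm hdim hab hsec W hW s₀ halg hexc hell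
  · exact hR f hf h𝒳 hirr haff hsm hdim hab hsec W hW s₀ halg hexc ⟨hns, hell⟩

/-- **THE REGISTERED `(6,3)` RUNG from (2a″), the elliptic-power carriers and the doubly residual cell** (no new pencil-level content beyond the
two per-variety carrier statements and the cell on pencils avoiding both kinds of special fibre). [cite: Markman2025SecantWeil, Thm. 1.4.1 and Thm. 1.5.1]
[cite: vanGeemen1994HodgeAV, Thm. 4.3 and Thm. 4.11] [cite: Bloch1972Semiregularity, Remark (7.5)] -/
theorem rung_sixfoldMiddleTw_of_anchorCarrier63Pinned_of_ellipticPowerCarrierAt_of_under_not_not {C : ChernCharacterBetti}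
    (hA : SecantQuotientAnchorCarrier63Pinned C)
    (hE : AnchoredCarrierAt (Literature.AlgebraicGeometry.HodgeTheory.twistedReflexiveClass C
        (fun n X₀ I E => Summit.Ventures.HSemireg.gluableSigmaAdmissible n X₀ I E ∨
          Literature.AlgebraicGeometry.HodgeTheory.bfSingleAdmissible n X₀ I E)) 6 3
      (fun X θ ↦ (∃ (A₀ E₀ : AbelianVariety ℂ) (N : ℕ), A₀.dim = 6 ∧ E₀.dim = 1 ∧ A₀.IsIsogenous (E₀.powSucc N) ∧
        Nonempty (A₀.X ≅ X)) ∧ IsPolarizationClass 6 X θ)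
      (fun X _ ↦ (algebraicClasses X 3 : Set (complexBetti X (2 * 3)))))
    (hR : LefAtExceptionalRegimeAtUnder (Literature.AlgebraicGeometry.HodgeTheory.twistedReflexiveClass C
        (fun n X₀ I E => Summit.Ventures.HSemireg.gluableSigmaAdmissible n X₀ I E ∨
          Literature.AlgebraicGeometry.HodgeTheory.bfSingleAdmissible n X₀ I E)) 6 3
      (fun _ S f W ↦ ¬ HasServedFibre 6 3 (fun X θ ↦ secantQuotientAnchorsPinned X θ)
          (fun X θ ↦ secantQuotientServedClassesPinned X θ) f W ∧
        ¬ ∃ (t : ComplexPoints S) (A₀ E₀ : AbelianVariety ℂ) (N : ℕ),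
          A₀.dim = 6 ∧ E₀.dim = 1 ∧ A₀.IsIsogenous (E₀.powSucc N) ∧ Nonempty (A₀.X ≅ fiberOver f t))) :
    LefAtExceptionalRegimeSixfoldMiddle (Literature.AlgebraicGeometry.HodgeTheory.twistedReflexiveClass C
      (fun n X₀ I E => Summit.Ventures.HSemireg.gluableSigmaAdmissible n X₀ I E ∨
        Literature.AlgebraicGeometry.HodgeTheory.bfSingleAdmissible n X₀ I E)) :=
  lefAtExceptionalRegimeSixfoldMiddle_of_anchoredCarrierAt_of_under_not hA
    (secantQuotientResidual63Pinned_of_ellipticPowerCarrierAt_of_under_not_not hE hR)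

/-! ## §4 The door-level form of the elliptic-power (or any anchored) carrier statement at `I = {p}`: no side degree is typed -/

/-- **A `{p−1}`-SEMIREGULAR VECTOR BUNDLE WITH A RATIONAL ALGEBRAIC `B`-FIELD AND `(e^{B₀} ch F)_p = a·w + c·θᵖ` AT EVERY ANCHOR GIVES THE
ANCHORED-CARRIER STATEMENT FOR THE TWISTED DOOR, WITH `I = {p}`** (any notion `Adm ⊇ bfSingleAdmissible`, any anchor data): the door's membership
is `twistedReflexiveClass_of_isISemiregular_twisted` with `I = {p}` (so `{q | q + 1 ∈ I} = {p − 1}`: only `σ_{p−1} : Ext²(F,F) → H^{p+1}(Ω^{p−1})`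
must be injective), and with `I = {p}` the side clause `∀ q ∈ I, q ≠ p → …` of `AnchoredCarrierAt` is EMPTY. Honest reading (module docstring):
mathematically the side conditions return through the deformation theory — this theorem records only what the TYPED door asks.
[cite: BuchweitzFlenner2003, Def. 4.1 and §5 (I-semiregular)] [cite: Pridham2024Semiregularity, Cor. 2.25 and Rem. 2.26]
[cite: Markman2025SecantWeil, §1.1 and §7.3] [cite: Bloch1972Semiregularity, Remark (7.5)] -/
theorem anchoredCarrierAt_twisted_of_forall_exists_isISemiregular {C : ChernCharacterBetti} {Adm : PerfectAdmissibility}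
    {𝔄 : ∀ X : SchemeOver ℂ, complexBetti X 2 → Prop} {𝔖 : ∀ (X : SchemeOver ℂ), complexBetti X 2 → Set (complexBetti X (2 * p))}
    (hAdm : ∀ n X₀ I E, bfSingleAdmissible n X₀ I E → Adm n X₀ I E)
    (h : ∀ (X : SchemeOver ℂ) (θ : complexBetti X 2), 𝔄 X θ → ∀ w ∈ 𝔖 X θ, IsRationalClass w →
      ∃ (F : X.left.Modules) (hF : IsFiniteLocallyFree F) (B₀ : complexBetti X 2) (a c : ℂ),
        IsISemiregular hF {q | q + 1 ∈ ({p} : Finset ℕ)} ∧ IsRationalClass B₀ ∧ B₀ ∈ algebraicClasses X 1 ∧ a ≠ 0 ∧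
        expTwistCh C X B₀ F p = a • w + c • cupPowTwo θ p) :
    AnchoredCarrierAt (twistedReflexiveClass C Adm) n p 𝔄 𝔖 := by
  intro X θ hXθ w hw hwQ
  obtain ⟨F, hF, B₀, a, c, hsr, hBQ, hBalg, ha, hκ⟩ := h X θ hXθ w hw hwQ
  refine ⟨{p}, fun q ↦ expTwistCh C X B₀ F q, a, fun _ ↦ c, Finset.mem_singleton_self p,
    twistedReflexiveClass_of_isISemiregular_twisted hAdm F hF hsr hBQ hBalg (fun q _ ↦ rfl), ha, hκ, fun q hq hqp ↦ ?_⟩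
  exact absurd (Finset.mem_singleton.1 hq) hqp

/-- **Instance: the ELLIPTIC-POWER carrier statement at `(6,3)` for the crux's door from `{2}`-semiregular vector bundles on elliptic-power
sixfolds** — for every `X ≅ A₀ ~ E₀⁶`, polarisation class `θ`, rational algebraic `w ∈ H⁶(X(ℂ); ℂ)`: a finite locally free `F`, a rational
algebraic `B₀` (e.g. `−c₁(F)/rk F`), `a ≠ 0`, `c` with `σ₂` injective on `Ext²(F,F)` and `(e^{B₀} ch F)₃ = a·w + c·θ³`. The cheapest
candidates (module docstring, §4): direct sums of line bundles ∕ of simple semi-homogeneous bundles — `Ext²` diagonal `⊕ H^{0,2}`, off-diagonal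
`H²(L_j ⊗ L_i⁻¹)` killed by the trace, hence to be ZERO (Mumford's index theorem: differences non-degenerate of index `≠ 2`).
[cite: BuchweitzFlenner2003, §5 (I-semiregular) and Thm. 5.1] [cite: MumfordAV1970, §16] [cite: Mukai1978, §5–§6]
[cite: Pridham2024Semiregularity, Cor. 2.25 and Rem. 2.26] -/
theorem ellipticPowerCarrierAt63_twAdm_of_forall_exists_isISemiregular {C : ChernCharacterBetti}
    (h : ∀ (X : SchemeOver ℂ) (θ : complexBetti X 2),
      ((∃ (A₀ E₀ : AbelianVariety ℂ) (N : ℕ), A₀.dim = 6 ∧ E₀.dim = 1 ∧ A₀.IsIsogenous (E₀.powSucc N) ∧ Nonempty (A₀.X ≅ X)) ∧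
        IsPolarizationClass 6 X θ) →
      ∀ w : complexBetti X (2 * 3), w ∈ algebraicClasses X 3 → IsRationalClass w →
      ∃ (F : X.left.Modules) (hF : IsFiniteLocallyFree F) (B₀ : complexBetti X 2) (a c : ℂ),
        IsISemiregular hF {q | q + 1 ∈ ({3} : Finset ℕ)} ∧ IsRationalClass B₀ ∧ B₀ ∈ algebraicClasses X 1 ∧ a ≠ 0 ∧
        expTwistCh C X B₀ F 3 = a • w + c • cupPowTwo θ 3) :
    AnchoredCarrierAt (Literature.AlgebraicGeometry.HodgeTheory.twistedReflexiveClass C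
        (fun n X₀ I E => Summit.Ventures.HSemireg.gluableSigmaAdmissible n X₀ I E ∨
          Literature.AlgebraicGeometry.HodgeTheory.bfSingleAdmissible n X₀ I E)) 6 3
      (fun X θ ↦ (∃ (A₀ E₀ : AbelianVariety ℂ) (N : ℕ), A₀.dim = 6 ∧ E₀.dim = 1 ∧ A₀.IsIsogenous (E₀.powSucc N) ∧
        Nonempty (A₀.X ≅ X)) ∧ IsPolarizationClass 6 X θ)
      (fun X _ ↦ (algebraicClasses X 3 : Set (complexBetti X (2 * 3)))) :=
  anchoredCarrierAt_twisted_of_forall_exists_isISemiregular (fun _ _ _ _ h ↦ Or.inr h) fun X θ hXθ w hw hwQ ↦ h X θ hXθ w hw hwQ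

end Summit.HodgeConjecture.HodgeConjecture.Ring2.SemiregularRepresentatives

end
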